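import Summits.QuantumFields.YangMills.Theorems.PencilRigidityWeakCouplingHypercubicLimitReflectedPairTransferForm
import Summits.QuantumFields.YangMills.Theorems.PencilRigidityWeakCouplingHypercubicLimitReflectedSpectralSums
import Summits.QuantumFields.YangMills.Theorems.PencilRigidityWeakCouplingHypercubicLimitRelativeBoundOfReflectedSums
import Summits.QuantumFields.YangMills.Theorems.PencilRigidityWeakCouplingHypercubicLimitStubRatioOfColdPressure
import HarnessLib

/-!
# Stub `stub_rpSpectralOfColdPressure` (R6) of line `Sketch`, crux `PencilRigidity.WeakCouplingHypercubicLimit`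
# (stmt-QuantumFields-16120): cold pressure forces the RP-spectral relative clustering of reflected slab functionals

At a fixed coupling `β ≥ 0`, a cold-pressure bound `traceExcess r.ρ β (2S+1) (m+2) ≤ C₀ (2S+1)³ e^{−g (m+2)}` on the
cold tori `S ≥ S₁`, `S + 1 ≤ 2(m+2)` gives, for every bounded measurable functional `Y` of the time slab `[1, T]` of `ℤ⁴`
(sup `B`), every torus `S ≥ S₁` with `2(T+n+1) ≤ S` and every rate `0 ≤ g' ≤ g`,
`|⟨ΘY · Y_n⟩ − ⟨Y⟩²| ≤ e^{−g' n} (⟨ΘY · Y⟩ − ⟨Y⟩²) + 16 C₀ (2S+1)³ e^{−3gS/4} B²` — the body of `GapData` (iii-b) /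
`IRInputs` (b) of the host closures of stmt-8646 / stmt-16154.  Assembly of the landed pieces: the transfer form of the
three expectations (`reflectedPair_transferForm`: slicing, cylinder property, rotation, gap-`(a+1)` two-block contraction,
transpose of the reflected block), the reflected spectral sums (`reflectedSpectralSums`: non-negative two-insertion
terms `λⱼ^{n+1} λᵢ^{2S−2T'−n+2} ⟪bⱼ, B̂ bᵢ⟫²`), the spectral ratio from cold pressure (`stub_ratioOfColdPressure`), and the
normalised bookkeeping (`relativeBound_of_reflectedSums` over `stub_relativeBookkeeping`); the block size is padded to
`T' = max T 2`, all thermal exponents are `≥ 3S/4` and cold, and the case `16·(trace excess) > 16` is a priori.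

References: K. Osterwalder, E. Seiler, Ann. Phys. 110 (1978) §§2–3; E. Seiler, LNP 159 (1982) Ch. 2; J. Glimm, A. Jaffe,
*Quantum Physics* (1987) §6.1. [folklore]
-/

noncomputable section

open scoped BigOperators Topology InnerProductSpace
open MeasureTheory Filter
open Literature.MathematicalPhysics.QuantumFieldTheory Literature.MathematicalPhysics.QuantumLattice

namespace Summit.QuantumFields.YangMills.Theorems.WeakCouplingHypercubicLimit.TraceNormColdPressure

/-- `stub_rpSpectralOfColdPressure` (R6, registered on stmt-QuantumFields-16120) — **cold pressure forces the
RP-spectral relative clustering of reflected slab functionals** at fixed `β ≥ 0`; see the module docstring.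
[folklore] -/
theorem stub_rpSpectralOfColdPressure :
    ∀ (G : Type) [Group G] [TopologicalSpace G] [IsTopologicalGroup G] [CompactSpace G]
      [MeasurableSpace G] [BorelSpace G] (r : LatticeRep G) (β : ℝ), 0 ≤ β →
    ∀ (g C₀ : ℝ) (S₁ : ℕ), 0 ≤ g → 0 ≤ C₀ →
      (∀ S : ℕ, S₁ ≤ S → ∀ m : ℕ, S + 1 ≤ 2 * (m + 2) →
        traceExcess r.ρ β (2 * S + 1) (m + 2) ≤ C₀ * ((2 * S + 1 : ℕ) : ℝ) ^ 3 * Real.exp (-(g * ((m + 2 : ℕ) : ℝ)))) →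
    ∀ (S T n : ℕ), S₁ ≤ S → 2 * (T + n + 1) ≤ S →
    ∀ (Y : LGConfig 4 G → ℝ) (B : ℝ), Measurable Y → (∀ U, |Y U| ≤ B) →
      DependsOn Y {e : Literature.MathematicalPhysics.QuantumLattice.ZdEdge 4 |
        1 ≤ e.1 0 ∧ e.1 0 + (if e.2 = 0 then 1 else 0) ≤ T} →
    ∀ g' : ℝ, 0 ≤ g' → g' ≤ g →
      |(∫ U, Y (torusLift (2 * S + 1) (GaugeConfig.timeReflect U)) *
            Y (configShift (-Pi.single 0 (n : ℤ)) (torusLift (2 * S + 1) U))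
          ∂(wilsonMeasure r.ρ β : Measure (GaugeConfig 4 (2 * S + 1) G))) -
        (∫ U, Y (torusLift (2 * S + 1) U) ∂(wilsonMeasure r.ρ β : Measure (GaugeConfig 4 (2 * S + 1) G))) ^ 2| ≤
      Real.exp (-(g' * n)) *
          ((∫ U, Y (torusLift (2 * S + 1) (GaugeConfig.timeReflect U)) * Y (torusLift (2 * S + 1) U)
              ∂(wilsonMeasure r.ρ β : Measure (GaugeConfig 4 (2 * S + 1) G))) -
            (∫ U, Y (torusLift (2 * S + 1) U) ∂(wilsonMeasure r.ρ β : Measure (GaugeConfig 4 (2 * S + 1) G))) ^ 2) +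
        16 * C₀ * ((2 * S + 1 : ℕ) : ℝ) ^ 3 * Real.exp (-(g * (3 * (S : ℝ) / 4))) * B ^ 2 := by
  intro G _ _ _ _ _ _ r β hβ g C₀ S₁ hg hC₀ hP S T n hS hgeom Y B hYm hYb hYd g' hg'0 hg'g
  haveI : SecondCountableTopology G :=
    (r.continuous.isClosedEmbedding r.injective).isEmbedding.secondCountableTopology
  haveI := isProbabilityMeasure_wilsonMeasure (d := 4) (L := 2 * S + 1) r.ρ r.continuous β
  -- a priori sizes
  have hB0 : 0 ≤ B := (abs_nonneg _).trans (hYb fun _ => 1)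
  have hI1 : |∫ U, Y (torusLift (2 * S + 1) U) ∂(wilsonMeasure r.ρ β : Measure (GaugeConfig 4 (2 * S + 1) G))| ≤ B := by
    have h := norm_integral_le_of_norm_le_const (μ := (wilsonMeasure r.ρ β : Measure (GaugeConfig 4 (2 * S + 1) G)))
      (f := fun U => Y (torusLift (2 * S + 1) U)) (C := B) (Eventually.of_forall fun U => by
        rw [Real.norm_eq_abs]; exact hYb _)
    simpa [Real.norm_eq_abs] using h
  have hI2 : ∀ F : GaugeConfig 4 (2 * S + 1) G → LGConfig 4 G,
      |∫ U, Y (torusLift (2 * S + 1) (GaugeConfig.timeReflect U)) * Y (F U)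
        ∂(wilsonMeasure r.ρ β : Measure (GaugeConfig 4 (2 * S + 1) G))| ≤ B ^ 2 := by
    intro F
    have h := norm_integral_le_of_norm_le_const (μ := (wilsonMeasure r.ρ β : Measure (GaugeConfig 4 (2 * S + 1) G)))
      (f := fun U => Y (torusLift (2 * S + 1) (GaugeConfig.timeReflect U)) * Y (F U)) (C := B ^ 2)
      (Eventually.of_forall fun U => by
        rw [Real.norm_eq_abs, abs_mul, pow_two]
        exact mul_le_mul (hYb _) (hYb _) (abs_nonneg _) hB0)
    simpa [Real.norm_eq_abs] using h
  have hsq : (∫ U, Y (torusLift (2 * S + 1) U) ∂(wilsonMeasure r.ρ β : Measure (GaugeConfig 4 (2 * S + 1) G))) ^ 2 ≤ B ^ 2 := by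
    have h := hI1
    rw [abs_le] at h
    nlinarith [h.1, h.2]
  have hsq0 : 0 ≤ (∫ U, Y (torusLift (2 * S + 1) U) ∂(wilsonMeasure r.ρ β : Measure (GaugeConfig 4 (2 * S + 1) G))) ^ 2 :=
    sq_nonneg _
  have hCovn := hI2 fun U => configShift (-Pi.single 0 (n : ℤ)) (torusLift (2 * S + 1) U)
  have hCov0 := hI2 fun U => torusLift (2 * S + 1) U
  rw [abs_le] at hCovn hCov0
  -- the thermal size `X`
  set X : ℝ := C₀ * ((2 * S + 1 : ℕ) : ℝ) ^ 3 * Real.exp (-(g * (3 * (S : ℝ) / 4))) with hXdef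
  have hX0 : 0 ≤ X := by positivity
  have hexp1 : Real.exp (-(g' * n)) ≤ 1 := Real.exp_le_one_iff.mpr (by nlinarith [Nat.cast_nonneg (α := ℝ) n])
  have hexp0 : 0 ≤ Real.exp (-(g' * n)) := (Real.exp_pos _).le
  -- the anchor term is at least `-2B²` after the rate factor
  have hanchor : -(2 * B ^ 2) ≤ Real.exp (-(g' * n)) *
      ((∫ U, Y (torusLift (2 * S + 1) (GaugeConfig.timeReflect U)) * Y (torusLift (2 * S + 1) U)
          ∂(wilsonMeasure r.ρ β : Measure (GaugeConfig 4 (2 * S + 1) G))) -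
        (∫ U, Y (torusLift (2 * S + 1) U) ∂(wilsonMeasure r.ρ β : Measure (GaugeConfig 4 (2 * S + 1) G))) ^ 2) := by
    set c := (∫ U, Y (torusLift (2 * S + 1) (GaugeConfig.timeReflect U)) * Y (torusLift (2 * S + 1) U)
          ∂(wilsonMeasure r.ρ β : Measure (GaugeConfig 4 (2 * S + 1) G))) -
        (∫ U, Y (torusLift (2 * S + 1) U) ∂(wilsonMeasure r.ρ β : Measure (GaugeConfig 4 (2 * S + 1) G))) ^ 2 with hc
    have hc2 : -(2 * B ^ 2) ≤ c := by rw [hc]; linarith [hCov0.1]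
    by_cases hc0 : 0 ≤ c
    · nlinarith [mul_nonneg hexp0 hc0, sq_nonneg B]
    · push Not at hc0
      nlinarith [mul_le_mul_of_nonpos_right hexp1 hc0.le]
  by_cases hX1 : X ≤ 1
  swap
  · -- a priori: `16 B² X ≥ 16 B²`
    push Not at hX1
    have h16 : 16 * B ^ 2 ≤ 16 * C₀ * ((2 * S + 1 : ℕ) : ℝ) ^ 3 * Real.exp (-(g * (3 * (S : ℝ) / 4))) * B ^ 2 := by
      have : 16 * B ^ 2 * 1 ≤ 16 * B ^ 2 * X := mul_le_mul_of_nonneg_left hX1.le (by positivity)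
      rw [hXdef] at this; linarith
    rw [abs_le]
    constructor <;> nlinarith [hCovn.1, hCovn.2, hsq, hsq0, hanchor, h16, sq_nonneg B]
  -- layout: block size `rr + 2 = max T 2`, gap `n`, arc `b'`
  obtain ⟨rr, b', hTrr, hN, h34⟩ : ∃ rr b' : ℕ, T ≤ rr + 2 ∧ 2 * S + 1 = 2 * rr + n + b' + 4 + 1 ∧ 3 * S ≤ 4 * (b' + 2) :=
    ⟨T - 2, 2 * S - 2 * (T - 2) - n - 4, by omega, by omega, by omega⟩
  have hYd' : DependsOn Y {e : Literature.MathematicalPhysics.QuantumLattice.ZdEdge 4 |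
      1 ≤ e.1 0 ∧ e.1 0 + (if e.2 = 0 then 1 else 0) ≤ ((rr + 2 : ℕ) : ℤ)} := by
    intro U V hUV
    refine hYd fun e he => hUV e ?_
    obtain ⟨h1, h2⟩ := he
    refine ⟨h1, h2.trans ?_⟩
    exact_mod_cast hTrr
  -- the transfer form of the three expectations
  obtain ⟨Xb, hXsm, hXbd, hXdom, h2n, h20, h1⟩ := reflectedPair_transferForm G r β hβ S rr n b' hN Y B hYm hYb hYd'
  -- the reflected spectral sums of the slice kernel
  obtain ⟨-, -, -, -, hK_sm, hK_symm, hK_bd, hK_pt⟩ := stub_sliceKernel G r (2 * S + 1) β hβ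
  obtain ⟨ι, hι, b, lam, i₀, Bop, hlam, hL0, hlam2, hnB, hlimsup, hZ, h7, h8⟩ :=
    reflectedSpectralSums (GaugeConfig 3 (2 * S + 1) G) (Measure.pi fun _ : Edge 3 (2 * S + 1) => haarProbability G)
      (wilsonSliceKernel r.ρ β) 1 hK_sm hK_symm hK_bd hK_pt rr Xb B B hXsm hXbd hXdom
  -- trace excesses are the normalised spectral sums; cold pressure bounds them
  have hlamtop : transferSpectralRadius r.ρ β (2 * S + 1) = lam i₀ := hlimsup
  have hZm : ∀ m : ℕ, ∑' i, lam i ^ (m + 2) = cyclicPartition r.ρ β (2 * S + 1) (m + 2) := fun m => (hZ m).tsum_eq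
  have htrace : ∀ m : ℕ, traceExcess r.ρ β (2 * S + 1) (m + 2) = (∑' i, lam i ^ (m + 2)) / lam i₀ ^ (m + 2) - 1 := by
    intro m; unfold traceExcess; rw [hlamtop, hZm]
  have hV : 0 < C₀ * ((2 * S + 1 : ℕ) : ℝ) ^ 3 + 1 := by positivity
  have hratio : ∀ i, i ≠ i₀ → lam i ≤ Real.exp (-g) * lam i₀ := by
    refine stub_ratioOfColdPressure ι lam i₀ (C₀ * ((2 * S + 1 : ℕ) : ℝ) ^ 3 + 1) 1 g S hlam hL0 hlam2 hV fun m hm => ?_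
    rw [← htrace m]
    calc traceExcess r.ρ β (2 * S + 1) (m + 2) ≤ C₀ * ((2 * S + 1 : ℕ) : ℝ) ^ 3 * Real.exp (-(g * ((m + 2 : ℕ) : ℝ))) :=
          hP S hS m (by omega)
      _ ≤ (C₀ * ((2 * S + 1 : ℕ) : ℝ) ^ 3 + 1) * 1 * Real.exp (-(g * ((m + 2 : ℕ) : ℝ))) := by
          nlinarith [Real.exp_pos (-(g * ((m + 2 : ℕ) : ℝ))), sq_nonneg C₀]
  have hXm : ∀ m : ℕ, b' ≤ m → (∑' i, lam i ^ (m + 2)) / lam i₀ ^ (m + 2) - 1 ≤ X := by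
    intro m hm
    rw [← htrace m]
    refine (hP S hS m (by omega)).trans ?_
    rw [hXdef]
    refine mul_le_mul_of_nonneg_left (Real.exp_le_exp.2 ?_) (by positivity)
    have h1 : (3 * (S : ℝ) / 4) ≤ ((m + 2 : ℕ) : ℝ) := by
      have : (3 * S : ℝ) ≤ 4 * ((m : ℝ) + 2) := by exact_mod_cast (h34.trans (by omega : 4 * (b' + 2) ≤ 4 * (m + 2)))
      push_cast; linarith
    nlinarith
  -- the relative bound
  have key := relativeBound_of_reflectedSums (Lp ℝ 2 (Measure.pi fun _ : Edge 3 (2 * S + 1) => haarProbability G)) ι b lam i₀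
    Bop B g g' X rr n b' _ _ _ _ hlam hL0 hnB hratio hg'0 hg'g hX0 hX1 (h7 n b') (h7 0 (n + b')) (h8 (rr + n + b' + 2))
    (hZ (2 * rr + n + b' + 3)) (hZ b').summable (hZ (n + b')).summable (hZ (rr + n + b' + 2)).summable (hXm b' le_rfl)
    (hXm (n + b') (by omega)) (hXm (rr + n + b' + 2) (by omega)) (hXm (2 * rr + n + b' + 3) (by omega))
  rw [h2n, h20, h1]
  refine key.trans (le_of_eq ?_)
  rw [hXdef]; ring

/-- **Along a scheme: the `IRInputs` (b) clause from cold pressure + the volume floor.**  If, eventually in `k`, the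
tori `S ≥ L_k` of a scheme obey the volume floor `C₀ (2S+1)³ e^{−Δ a_k S/2} ≤ K` and the cold-pressure bound at rate
`Δ a_k` (with `β_k ≥ 0`, automatic at weak coupling), then eventually in `k`, for every bounded measurable slab functional
`Y` of `[1, T]` and `2(T+n+1) ≤ S`, `S ≥ L_k`:
`|⟨ΘY · Y_n⟩ − ⟨Y⟩²| ≤ e^{−(Δ/4) a_k n} (⟨ΘY · Y⟩ − ⟨Y⟩²) + 16 K B² e^{−(Δ/4) a_k S}` — the RP-spectral input of the
coupling-response host of stmt-16154 at rate `Δ/4` (`stub_rpSpectralOfColdPressure` with `g = Δ a_k`, `g' = Δ a_k/4`, and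
`e^{−3 Δ a_k S/4} = e^{−Δ a_k S/2} e^{−Δ a_k S/4}`). [folklore] -/
theorem rpSpectral_of_coldPressure_scheme :
    ∀ (G : Type) [Group G] [TopologicalSpace G] [IsTopologicalGroup G] [CompactSpace G]
      [MeasurableSpace G] [BorelSpace G] (r : LatticeRep G) (κ : Type) (sch : SpeciesScheme κ) (Δ C₀ K : ℝ),
      (∀ᶠ k in atTop, 0 ≤ sch.β k) → 0 < Δ → 0 ≤ C₀ →
      (∀ᶠ k in atTop, ∀ S : ℕ, sch.L k ≤ S →
        C₀ * ((2 * S + 1 : ℕ) : ℝ) ^ 3 * Real.exp (-(Δ * sch.a k * S / 2)) ≤ K) →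
      (∀ᶠ k in atTop, ∀ S : ℕ, sch.L k ≤ S → ∀ m : ℕ, S + 1 ≤ 2 * (m + 2) →
        traceExcess r.ρ (sch.β k) (2 * S + 1) (m + 2) ≤
          C₀ * ((2 * S + 1 : ℕ) : ℝ) ^ 3 * Real.exp (-(Δ * sch.a k * ((m + 2 : ℕ) : ℝ)))) →
      ∀ᶠ k in atTop, ∀ (S T n : ℕ), sch.L k ≤ S → 2 * (T + n + 1) ≤ S →
        ∀ (Y : LGConfig 4 G → ℝ) (B : ℝ), Measurable Y → (∀ U, |Y U| ≤ B) →
          DependsOn Y {e : Literature.MathematicalPhysics.QuantumLattice.ZdEdge 4 |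
            1 ≤ e.1 0 ∧ e.1 0 + (if e.2 = 0 then 1 else 0) ≤ T} →
          |(∫ U, Y (torusLift (2 * S + 1) (GaugeConfig.timeReflect U)) *
                Y (configShift (-Pi.single 0 (n : ℤ)) (torusLift (2 * S + 1) U))
              ∂(wilsonMeasure r.ρ (sch.β k) : Measure (GaugeConfig 4 (2 * S + 1) G))) -
            (∫ U, Y (torusLift (2 * S + 1) U) ∂(wilsonMeasure r.ρ (sch.β k) : Measure (GaugeConfig 4 (2 * S + 1) G))) ^ 2| ≤
          Real.exp (-(Δ / 4 * sch.a k * n)) *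
              ((∫ U, Y (torusLift (2 * S + 1) (GaugeConfig.timeReflect U)) * Y (torusLift (2 * S + 1) U)
                  ∂(wilsonMeasure r.ρ (sch.β k) : Measure (GaugeConfig 4 (2 * S + 1) G))) -
                (∫ U, Y (torusLift (2 * S + 1) U) ∂(wilsonMeasure r.ρ (sch.β k) : Measure (GaugeConfig 4 (2 * S + 1) G))) ^ 2) +
            16 * K * B ^ 2 * Real.exp (-(Δ / 4 * sch.a k * S)) := by
  intro G _ _ _ _ _ _ r κ sch Δ C₀ K hβ hΔ hC₀ hK hP
  filter_upwards [hβ, hK, hP] with k hβk hKk hPk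
  intro S T n hS hgeom Y B hYm hYb hYd
  have ha : 0 < sch.a k := sch.a_pos k
  have hg : 0 ≤ Δ * sch.a k := by positivity
  have h := stub_rpSpectralOfColdPressure G r (sch.β k) hβk (Δ * sch.a k) C₀ (sch.L k) hg hC₀
    (fun S' hS' m hm => hPk S' hS' m hm) S T n hS hgeom Y B hYm hYb hYd (Δ / 4 * sch.a k) (by positivity) (by nlinarith)
  refine h.trans (add_le_add (le_of_eq (by ring_nf)) ?_)
  have hsplit : Real.exp (-(Δ * sch.a k * (3 * (S : ℝ) / 4))) =
      Real.exp (-(Δ * sch.a k * S / 2)) * Real.exp (-(Δ / 4 * sch.a k * S)) := by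
    rw [← Real.exp_add]; ring_nf
  rw [hsplit]
  have hB2 : 0 ≤ B ^ 2 := sq_nonneg B
  have hE : 0 ≤ Real.exp (-(Δ / 4 * sch.a k * S)) := (Real.exp_pos _).le
  have hfloor := hKk S hS
  calc 16 * C₀ * ((2 * S + 1 : ℕ) : ℝ) ^ 3 * (Real.exp (-(Δ * sch.a k * S / 2)) * Real.exp (-(Δ / 4 * sch.a k * S))) * B ^ 2
      = 16 * (C₀ * ((2 * S + 1 : ℕ) : ℝ) ^ 3 * Real.exp (-(Δ * sch.a k * S / 2))) * (Real.exp (-(Δ / 4 * sch.a k * S)) * B ^ 2) := by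
        ring
    _ ≤ 16 * K * (Real.exp (-(Δ / 4 * sch.a k * S)) * B ^ 2) := by
        exact mul_le_mul_of_nonneg_right (mul_le_mul_of_nonneg_left hfloor (by norm_num)) (mul_nonneg hE hB2)
    _ = 16 * K * B ^ 2 * Real.exp (-(Δ / 4 * sch.a k * S)) := by ring

end Summit.QuantumFields.YangMills.Theorems.WeakCouplingHypercubicLimit.TraceNormColdPressure

end
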